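import Mathlib
import HarnessLib
import Summits.KontsevichZagierPeriods.Zeta5Search.Denom.LineProfileShape

/-!
# The second-tale line profile at RUNG D1 = L(1/3) and its shape at `ξ = −1318/100` (DecayTD1, one-variable side)

HONEST FRAMING: systematic search; no irrationality claim unless certified.  This file proves
elementary real-analysis facts about an explicit function of one variable; no statement about
`ζ(2)`, `ζ(5)` or any linear form is made here.  Cell pub-zeta5 (P1 g12; file M5 of fam-denom's
`families/denom/D1-DESIGN-NOTE.md`, design `families/measure/D1-DECAYT-DESIGN.md` §2–§5 (fam-measure g7),
P15 precedent `TwoTaleD1SecondLineProfileShape` (P1 g10), whose proofs are followed line by line).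
The second tale at the Remark-5 partner `(47n+2; 16n+1, 19n+1, 22n+1 | 22n+2; 9n+1, 35n+2, 38n+2)` of D1:
in the variable `w = t/n = ξ + iη` the rational function
`R̂(t) = ∏_{l=22n+2}^{47n+1}(2t+l)/(25n)! · ∏_{i=9n+1}^{16n}(t+i)/(7n)! · (16n)!²/(∏_{k=19n+1}^{35n+1}(t+k)∏_{k=22n+1}^{38n+1}(t+k))`
has the scaled line profile — with the generic primitive `gPrim` of `Denom/LineProfile.lean` —
`profileTD1 ξ η = profileTD10 ξ η − 2π|η|`,
`profileTD10 ξ η = 2(gPrim η (ξ+47/2) − gPrim η (ξ+11)) + (gPrim η (ξ+16) − gPrim η (ξ+9))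
 − (gPrim η (ξ+35) − gPrim η (ξ+19)) − (gPrim η (ξ+38) − gPrim η (ξ+22)) + profileTD1Const`,
`profileTD1Const = 32 log 16 − 25 log 25 − 7 log 7 + 25 log 2` (fam-measure's `κ_T(D1) = −5.37042755` plus the
doubled block's `25 log 2`).  On the design line `ξ₀ = −1318/100` (model optimum `ξ* = −13.17735`, rounding loss
`4.9·10⁻⁶` nats; two independent implementations agree: fam-measure `rateT_D1.py`, P1 `code/p1/g12/d1_tale2_profile.py`)
put `PTD η = profileTD1 (−1318/100) η`, `DTD η = angleTD1 (−1318/100) η − 2π`: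
* `DTD_eq`: `DTD = numLegsTD − denAngleTD1 − denAngleTD2 − 2π`, numerator legs `2·arctan(1032/(100η)) +
  2·arctan(218/(100η)) + arctan(282/(100η)) + arctan(418/(100η))` (antitone), denominator angles
  `arctan (16η/(η² + 1269924/10000))`, `arctan (16η/(η² + 2189124/10000))` (monotone on `(0, 11]`).
* `DTD_antitoneOn` (`PTD` concave on `(0, 11]`), `DTD_neg_of_ge`, `DTD_le_neg_three` (`η ≥ 11`: `32/11 + 3 < 2π`), `PTD_tail`.
* `twoPointTD`: if `0 < η₁ ≤ η₂ ≤ 11`, `0 ≤ DTD η₁`, `DTD η₂ ≤ 0` then `PTD η ≤ PTD η₁ + DTD η₁ (η₂ − η₁)` for all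
  `η > 0`;  `PTD_eq`: `PTD` as eight signed values `gPrim η (p/100)` plus `profileTD1Const − 2π|η|`.
The numerical instance (design optimum `η* = 1.86981`, `sup PTD = −42.3343781…`) is certified in
`TwoTaleD1SecondLineCertificate.lean`.
-/

noncomputable section

open Real Set

namespace Summit.KontsevichZagierPeriods.Zeta5Search.TwoTaleD1SecondLineProfileShape

open Summit.KontsevichZagierPeriods.Zeta5Search.Denom.LineProfile
open Summit.KontsevichZagierPeriods.Zeta5Search.Denom.LineProfileShape (arctan_div_anti)

/-! ## The second-tale profile (generic abscissa `ξ`) -/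

/-- The constant `32 log 16 − 25 log 25 − 7 log 7 + 25 log 2` of the D1 second-tale profile. -/
def profileTD1Const : ℝ :=
  32 * Real.log 16 - 25 * Real.log 25 - 7 * Real.log 7 + 25 * Real.log 2

/-- `profileTD10 ξ η`: the `2π|η|`-free part of the D1 second-tale line profile at abscissa `ξ` —
doubled numerator block `(ξ+47/2 | ξ+11)` with weight `2`, numerator block `(ξ+16 | ξ+9)`,
denominator blocks `(ξ+35 | ξ+19)`, `(ξ+38 | ξ+22)`, and `profileTD1Const`. -/
def profileTD10 (ξ η : ℝ) : ℝ :=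
  2 * (gPrim η (ξ + 47 / 2) - gPrim η (ξ + 11)) + (gPrim η (ξ + 16) - gPrim η (ξ + 9))
    - (gPrim η (ξ + 35) - gPrim η (ξ + 19)) - (gPrim η (ξ + 38) - gPrim η (ξ + 22)) + profileTD1Const

/-- The second-tale line profile `profileTD1 ξ η = profileTD10 ξ η − 2π|η|`. -/
def profileTD1 (ξ η : ℝ) : ℝ := profileTD10 ξ η - 2 * Real.pi * |η|

/-- `angleTD1 ξ η`: the `η`-derivative of `profileTD10 ξ` (a signed sum of eight angles). -/
def angleTD1 (ξ η : ℝ) : ℝ :=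
  2 * (Real.arctan ((ξ + 47 / 2) / η) - Real.arctan ((ξ + 11) / η))
    + (Real.arctan ((ξ + 16) / η) - Real.arctan ((ξ + 9) / η))
    - (Real.arctan ((ξ + 35) / η) - Real.arctan ((ξ + 19) / η))
    - (Real.arctan ((ξ + 38) / η) - Real.arctan ((ξ + 22) / η))

/-- `profileTD10` is even in `η`. -/
theorem profileTD10_neg_eta (ξ η : ℝ) : profileTD10 ξ (-η) = profileTD10 ξ η := by
  simp only [profileTD10, gPrim_neg_eta]

/-- `profileTD1` is even in `η`. -/
theorem profileTD1_neg_eta (ξ η : ℝ) : profileTD1 ξ (-η) = profileTD1 ξ η := by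
  simp only [profileTD1, profileTD10_neg_eta, abs_neg]

/-- `d/dη profileTD10 ξ η = angleTD1 ξ η` for `η ≠ 0`. -/
theorem hasDerivAt_profileTD10_eta (ξ : ℝ) {η : ℝ} (hη : η ≠ 0) :
    HasDerivAt (fun η : ℝ => profileTD10 ξ η) (angleTD1 ξ η) η := by
  have h := fun w => hasDerivAt_gPrim_eta hη w
  have key := (((((h (ξ + 47 / 2)).sub (h (ξ + 11))).const_mul 2).add ((h (ξ + 16)).sub (h (ξ + 9)))).sub
    ((h (ξ + 35)).sub (h (ξ + 19)))).sub ((h (ξ + 38)).sub (h (ξ + 22))) |>.add_const profileTD1Const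
  exact key

/-- `d/dη profileTD1 ξ η = angleTD1 ξ η − 2π` for `η > 0`. -/
theorem hasDerivAt_profileTD1_eta (ξ : ℝ) {η : ℝ} (hη : 0 < η) :
    HasDerivAt (fun η : ℝ => profileTD1 ξ η) (angleTD1 ξ η - 2 * Real.pi) η := by
  have habs : HasDerivAt (fun η : ℝ => 2 * Real.pi * |η|) (2 * Real.pi * 1) η := by
    refine ((hasDerivAt_id' η).congr_of_eventuallyEq ?_).const_mul (2 * Real.pi)
    filter_upwards [Ioi_mem_nhds hη] with x hx using abs_of_pos hx
  have key : HasDerivAt (fun η : ℝ => profileTD10 ξ η - 2 * Real.pi * |η|)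
      (angleTD1 ξ η - 2 * Real.pi * 1) η := (hasDerivAt_profileTD10_eta ξ hη.ne').sub habs
  rw [mul_one] at key
  exact key

/-- `profileTD1 ξ` is continuous on `(0, ∞)`. -/
theorem continuousOn_profileTD1 (ξ : ℝ) : ContinuousOn (fun η : ℝ => profileTD1 ξ η) (Ioi 0) :=
  fun _ hη => (hasDerivAt_profileTD1_eta ξ hη).continuousAt.continuousWithinAt

/-! ## The line `ξ = −1318/100` -/

/-- `PTD η = profileTD1 (−1318/100) η`, the second-tale line profile on the saddle line `ξ = −13.18`. -/
def PTD (η : ℝ) : ℝ := profileTD1 (-1318 / 100) η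

/-- `DTD η = angleTD1 (−1318/100) η − 2π` (the derivative of `PTD` on `(0, ∞)`). -/
def DTD (η : ℝ) : ℝ := angleTD1 (-1318 / 100) η - 2 * Real.pi

/-- The numerator legs: `2·arctan(1032/(100η)) + 2·arctan(218/(100η)) + arctan(282/(100η)) + arctan(418/(100η))`. -/
def numLegsTD (η : ℝ) : ℝ :=
  2 * Real.arctan (1032 / 100 / η) + 2 * Real.arctan (218 / 100 / η)
    + Real.arctan (282 / 100 / η) + Real.arctan (418 / 100 / η)

/-- The first denominator angle `arctan (2182/(100η)) − arctan (582/(100η))`. -/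
def denAngleTD1 (η : ℝ) : ℝ := Real.arctan (2182 / 100 / η) - Real.arctan (582 / 100 / η)

/-- The second denominator angle `arctan (2482/(100η)) − arctan (882/(100η))`. -/
def denAngleTD2 (η : ℝ) : ℝ := Real.arctan (2482 / 100 / η) - Real.arctan (882 / 100 / η)

/-- `d/dη PTD = DTD` on `(0, ∞)`. -/
theorem hasDerivAt_PTD {η : ℝ} (hη : 0 < η) : HasDerivAt PTD (DTD η) η :=
  hasDerivAt_profileTD1_eta (-1318 / 100) hη

/-- `DTD = numLegsTD − denAngleTD1 − denAngleTD2 − 2π`. -/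
theorem DTD_eq (η : ℝ) : DTD η = numLegsTD η - denAngleTD1 η - denAngleTD2 η - 2 * Real.pi := by
  simp only [DTD, angleTD1, numLegsTD, denAngleTD1, denAngleTD2]
  have e1 : ((-1318 : ℝ) / 100 + 47 / 2) / η = 1032 / 100 / η := by ring
  have e2 : ((-1318 : ℝ) / 100 + 11) / η = -(218 / 100 / η) := by ring
  have e3 : ((-1318 : ℝ) / 100 + 16) / η = 282 / 100 / η := by ring
  have e4 : ((-1318 : ℝ) / 100 + 9) / η = -(418 / 100 / η) := by ring
  have e5 : ((-1318 : ℝ) / 100 + 35) / η = 2182 / 100 / η := by ring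
  have e6 : ((-1318 : ℝ) / 100 + 19) / η = 582 / 100 / η := by ring
  have e7 : ((-1318 : ℝ) / 100 + 38) / η = 2482 / 100 / η := by ring
  have e8 : ((-1318 : ℝ) / 100 + 22) / η = 882 / 100 / η := by ring
  rw [e1, e2, e3, e4, e5, e6, e7, e8, Real.arctan_neg, Real.arctan_neg]
  ring

/-- `PTD = (eight signed values of gPrim) + profileTD1Const − 2π|η|`. -/
theorem PTD_eq (η : ℝ) : PTD η =
    2 * gPrim η (1032 / 100) + 2 * gPrim η (218 / 100) + gPrim η (282 / 100) + gPrim η (418 / 100)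
      - gPrim η (2182 / 100) + gPrim η (582 / 100) - gPrim η (2482 / 100) + gPrim η (882 / 100)
      + profileTD1Const - 2 * Real.pi * |η| := by
  simp only [PTD, profileTD1, profileTD10]
  have e1 : gPrim η ((-1318 : ℝ) / 100 + 47 / 2) = gPrim η (1032 / 100) := by norm_num
  have e2 : gPrim η ((-1318 : ℝ) / 100 + 11) = -gPrim η (218 / 100) := by
    rw [show ((-1318 : ℝ) / 100 + 11) = -(218 / 100) by norm_num, gPrim_neg]
  have e3 : gPrim η ((-1318 : ℝ) / 100 + 16) = gPrim η (282 / 100) := by norm_num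
  have e4 : gPrim η ((-1318 : ℝ) / 100 + 9) = -gPrim η (418 / 100) := by
    rw [show ((-1318 : ℝ) / 100 + 9) = -(418 / 100) by norm_num, gPrim_neg]
  have e5 : gPrim η ((-1318 : ℝ) / 100 + 35) = gPrim η (2182 / 100) := by norm_num
  have e6 : gPrim η ((-1318 : ℝ) / 100 + 19) = gPrim η (582 / 100) := by norm_num
  have e7 : gPrim η ((-1318 : ℝ) / 100 + 38) = gPrim η (2482 / 100) := by norm_num
  have e8 : gPrim η ((-1318 : ℝ) / 100 + 22) = gPrim η (882 / 100) := by norm_num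
  rw [e1, e2, e3, e4, e5, e6, e7, e8]
  ring

/-- Closed form `denAngleTD1 η = arctan (16η / (η² + 1269924/10000))` for `η > 0`. -/
theorem denAngleTD1_eq {η : ℝ} (hη : 0 < η) :
    denAngleTD1 η = Real.arctan (16 * η / (η ^ 2 + 1269924 / 10000)) := by
  have hη' : η ≠ 0 := hη.ne'
  unfold denAngleTD1
  have hx : 0 < 2182 / 100 / η := by positivity
  have hy : 0 < 582 / 100 / η := by positivity
  have h1 : (2182 / 100 / η) * (-(582 / 100 / η)) < 1 := by nlinarith
  rw [sub_eq_add_neg, ← Real.arctan_neg, Real.arctan_add h1]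
  congr 1
  have hD1 : (1 - 2182 / 100 / η * -(582 / 100 / η)) ≠ 0 := by
    have : 0 < 1 - 2182 / 100 / η * -(582 / 100 / η) := by nlinarith [mul_pos hx hy]
    exact this.ne'
  have hD2 : η ^ 2 + 1269924 / 10000 ≠ 0 := by positivity
  rw [div_eq_div_iff hD1 hD2]
  field_simp
  ring

/-- Closed form `denAngleTD2 η = arctan (16η / (η² + 2189124/10000))` for `η > 0`. -/
theorem denAngleTD2_eq {η : ℝ} (hη : 0 < η) :
    denAngleTD2 η = Real.arctan (16 * η / (η ^ 2 + 2189124 / 10000)) := by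
  have hη' : η ≠ 0 := hη.ne'
  unfold denAngleTD2
  have hx : 0 < 2482 / 100 / η := by positivity
  have hy : 0 < 882 / 100 / η := by positivity
  have h1 : (2482 / 100 / η) * (-(882 / 100 / η)) < 1 := by nlinarith
  rw [sub_eq_add_neg, ← Real.arctan_neg, Real.arctan_add h1]
  congr 1
  have hD1 : (1 - 2482 / 100 / η * -(882 / 100 / η)) ≠ 0 := by
    have : 0 < 1 - 2482 / 100 / η * -(882 / 100 / η) := by nlinarith [mul_pos hx hy]
    exact this.ne'
  have hD2 : η ^ 2 + 2189124 / 10000 ≠ 0 := by positivity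
  rw [div_eq_div_iff hD1 hD2]
  field_simp
  ring

/-- `denAngleTD1` is monotone on `(0, 11]` (`11² ≤ 1269924/10000`). -/
theorem denAngleTD1_mono {s t : ℝ} (hs : 0 < s) (hst : s ≤ t) (ht : t ≤ 11) :
    denAngleTD1 s ≤ denAngleTD1 t := by
  rw [denAngleTD1_eq hs, denAngleTD1_eq (hs.trans_le hst)]
  apply Real.arctan_mono
  rw [div_le_div_iff₀ (by positivity) (by positivity)]
  have hst' : s * t ≤ 11 * 11 := mul_le_mul (hst.trans ht) ht (hs.le.trans hst) (by norm_num)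
  nlinarith [mul_nonneg (sub_nonneg.2 hst) (by linarith : (0 : ℝ) ≤ 1269924 / 10000 - s * t)]

/-- `denAngleTD2` is monotone on `(0, 11]` (`11² ≤ 2189124/10000`). -/
theorem denAngleTD2_mono {s t : ℝ} (hs : 0 < s) (hst : s ≤ t) (ht : t ≤ 11) :
    denAngleTD2 s ≤ denAngleTD2 t := by
  rw [denAngleTD2_eq hs, denAngleTD2_eq (hs.trans_le hst)]
  apply Real.arctan_mono
  rw [div_le_div_iff₀ (by positivity) (by positivity)]
  have hst' : s * t ≤ 11 * 11 := mul_le_mul (hst.trans ht) ht (hs.le.trans hst) (by norm_num)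
  nlinarith [mul_nonneg (sub_nonneg.2 hst) (by linarith : (0 : ℝ) ≤ 2189124 / 10000 - s * t)]

/-- `DTD` is antitone on `(0, 11]`. -/
theorem DTD_antitoneOn {s t : ℝ} (hs : 0 < s) (hst : s ≤ t) (ht : t ≤ 11) : DTD t ≤ DTD s := by
  rw [DTD_eq, DTD_eq]
  have hd1 := denAngleTD1_mono hs hst ht
  have hd2 := denAngleTD2_mono hs hst ht
  have l1 := arctan_div_anti (1032 / 100) (by norm_num) hs hst
  have l2 := arctan_div_anti (218 / 100) (by norm_num) hs hst
  have l3 := arctan_div_anti (282 / 100) (by norm_num) hs hst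
  have l4 := arctan_div_anti (418 / 100) (by norm_num) hs hst
  unfold numLegsTD
  linarith

/-- The leg bound `arctan (c/η) ≤ c/11` for `η ≥ 11`, `c ≥ 0`. -/
theorem legTD_le {η c : ℝ} (hη : 11 ≤ η) (hc : 0 ≤ c) : Real.arctan (c / η) ≤ c / 11 := by
  have hη0 : 0 < η := by linarith
  refine (show Real.arctan (c / η) ≤ c / η from ?_).trans (div_le_div_of_nonneg_left hc (by norm_num) hη)
  have ht : (0 : ℝ) ≤ c / η := div_nonneg hc hη0.le
  have h0 : 0 ≤ Real.arctan (c / η) := by simpa using Real.arctan_mono ht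
  have h := Real.le_tan h0 (Real.arctan_lt_pi_div_two _)
  rwa [Real.tan_arctan] at h

/-- Both denominator angles are nonnegative for `η > 0`. -/
theorem denAnglesTD_nonneg {η : ℝ} (hη : 0 < η) : 0 ≤ denAngleTD1 η ∧ 0 ≤ denAngleTD2 η := by
  unfold denAngleTD1 denAngleTD2
  have h1 : Real.arctan (582 / 100 / η) ≤ Real.arctan (2182 / 100 / η) :=
    Real.arctan_mono (div_le_div_of_nonneg_right (by norm_num) hη.le)
  have h2 : Real.arctan (882 / 100 / η) ≤ Real.arctan (2482 / 100 / η) :=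
    Real.arctan_mono (div_le_div_of_nonneg_right (by norm_num) hη.le)
  constructor <;> linarith

/-- `DTD η < 0` for `η ≥ 11` (`arctan x ≤ x`, `32/11 < 2π`). -/
theorem DTD_neg_of_ge {η : ℝ} (hη : 11 ≤ η) : DTD η < 0 := by
  rw [DTD_eq]
  have hη0 : 0 < η := by linarith
  obtain ⟨hd1, hd2⟩ := denAnglesTD_nonneg hη0
  have l1 := legTD_le hη (by norm_num : (0 : ℝ) ≤ 1032 / 100)
  have l2 := legTD_le hη (by norm_num : (0 : ℝ) ≤ 218 / 100)
  have l3 := legTD_le hη (by norm_num : (0 : ℝ) ≤ 282 / 100)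
  have l4 := legTD_le hη (by norm_num : (0 : ℝ) ≤ 418 / 100)
  unfold numLegsTD
  nlinarith [Real.pi_gt_three]

/-- `DTD η ≤ −3` for `η ≥ 11` (`32/11 + 3 < 2π`). -/
theorem DTD_le_neg_three {η : ℝ} (hη : 11 ≤ η) : DTD η ≤ -3 := by
  rw [DTD_eq]
  have hη0 : 0 < η := by linarith
  obtain ⟨hd1, hd2⟩ := denAnglesTD_nonneg hη0
  have l1 := legTD_le hη (by norm_num : (0 : ℝ) ≤ 1032 / 100)
  have l2 := legTD_le hη (by norm_num : (0 : ℝ) ≤ 218 / 100)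
  have l3 := legTD_le hη (by norm_num : (0 : ℝ) ≤ 282 / 100)
  have l4 := legTD_le hη (by norm_num : (0 : ℝ) ≤ 418 / 100)
  unfold numLegsTD
  linarith [Real.pi_gt_d2]

/-- Tail slope: `PTD η ≤ PTD 11 − 3 (η − 11)` for `η ≥ 11` (mean value theorem and `DTD_le_neg_three`). -/
theorem PTD_tail {η : ℝ} (hη : 11 ≤ η) : PTD η ≤ PTD 11 - 3 * (η - 11) := by
  rcases hη.eq_or_lt with h | hlt
  · rw [← h]
    simp
  have cont : ContinuousOn PTD (Icc 11 η) :=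
    (continuousOn_profileTD1 (-1318 / 100)).mono fun x hx => lt_of_lt_of_le (by norm_num) hx.1
  have deriv : ∀ x ∈ Ioo 11 η, HasDerivAt PTD (DTD x) x := fun x hx =>
    hasDerivAt_PTD (lt_trans (by norm_num) hx.1)
  obtain ⟨ξ, hξ, hslope⟩ := exists_hasDerivAt_eq_slope PTD DTD hlt cont deriv
  have h3 : DTD ξ ≤ -3 := DTD_le_neg_three hξ.1.le
  rw [hslope, div_le_iff₀ (by linarith)] at h3
  linarith

/-- **Two-point tangent lemma.**  If `0 < η₁ ≤ η₂ ≤ 11`, `0 ≤ DTD η₁` and `DTD η₂ ≤ 0`, then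
`PTD η ≤ PTD η₁ + DTD η₁ · (η₂ − η₁)` for every `η > 0`. -/
theorem twoPointTD {η₁ η₂ : ℝ} (h1 : 0 < η₁) (h12 : η₁ ≤ η₂) (h2 : η₂ ≤ 11) (hD1 : 0 ≤ DTD η₁)
    (hD2 : DTD η₂ ≤ 0) {η : ℝ} (hη : 0 < η) : PTD η ≤ PTD η₁ + DTD η₁ * (η₂ - η₁) := by
  have cont : ∀ a b : ℝ, 0 < a → ContinuousOn PTD (Icc a b) := fun a b ha =>
    (continuousOn_profileTD1 (-1318 / 100)).mono fun x hx => lt_of_lt_of_le ha hx.1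
  have diff : ∀ a b : ℝ, 0 < a → DifferentiableOn ℝ PTD (interior (Icc a b)) :=
    fun a b ha x hx => by
      rw [interior_Icc] at hx
      exact (hasDerivAt_PTD (ha.trans hx.1)).differentiableAt.differentiableWithinAt
  have der : ∀ x : ℝ, 0 < x → deriv PTD x = DTD x := fun x hx => (hasDerivAt_PTD hx).deriv
  have h2pos : 0 < η₂ := h1.trans_le h12
  have mid : ∀ y : ℝ, η₁ ≤ y → y ≤ η₂ → PTD y - PTD η₁ ≤ DTD η₁ * (y - η₁) :=
    fun y hy1 hy2 =>
    (convex_Icc η₁ y).image_sub_le_mul_sub_of_deriv_le (cont η₁ y h1) (diff η₁ y h1)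
      (C := DTD η₁)
      (fun x hx => by
        rw [interior_Icc] at hx
        rw [der x (h1.trans hx.1)]
        exact DTD_antitoneOn h1 hx.1.le (by linarith [hx.2]))
      η₁ ⟨le_rfl, hy1⟩ y ⟨hy1, le_rfl⟩ hy1
  rcases le_total η η₁ with hle | hge
  · have mono : MonotoneOn PTD (Icc η η₁) :=
      monotoneOn_of_deriv_nonneg (convex_Icc η η₁) (cont η η₁ hη) (diff η η₁ hη) fun x hx => by
        rw [interior_Icc] at hx
        rw [der x (hη.trans hx.1)]
        exact hD1.trans (DTD_antitoneOn (hη.trans hx.1) hx.2.le (h12.trans h2))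
    have := mono ⟨le_rfl, hle⟩ ⟨hle, le_rfl⟩ hle
    nlinarith [mul_nonneg hD1 (sub_nonneg.2 h12)]
  · rcases le_total η η₂ with hle2 | hge2
    · have := mid η hge hle2
      nlinarith [mul_le_mul_of_nonneg_left (by linarith : η - η₁ ≤ η₂ - η₁) hD1]
    · have anti : AntitoneOn PTD (Icc η₂ η) :=
        antitoneOn_of_deriv_nonpos (convex_Icc η₂ η) (cont η₂ η h2pos) (diff η₂ η h2pos)
          fun x hx => by
            rw [interior_Icc] at hx
            rw [der x (h2pos.trans hx.1)]
            rcases le_or_gt x 11 with hx7 | hx7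
            · exact (DTD_antitoneOn h2pos hx.1.le hx7).trans hD2
            · exact (DTD_neg_of_ge hx7.le).le
      have hA := anti ⟨le_rfl, hge2⟩ ⟨hge2, le_rfl⟩ hge2
      have := mid η₂ h12 le_rfl
      linarith

end Summit.KontsevichZagierPeriods.Zeta5Search.TwoTaleD1SecondLineProfileShape

end
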